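import Literature.NumberTheory.LFunctions.HorocycleStripFourier
import HarnessLib

/-!
# The Fourier series of `|sin θ|`

Support file (everything PROVED; no named facts) for the Montgomery–Vaughan / Roy–Vatwani bound on
ratios of `ζ` at horizontally displaced points (Roy–Vatwani 2019, Lemma 7.2, display (eq:fourier sin)):
the absolutely convergent Fourier expansion

`|sin x| = ∑_{m ∈ ℤ} (2 / (π (1 − 4m²))) e^{2imx} = 2/π − (4/π) ∑_{m ≥ 1} cos(2mx)/(4m² − 1)`

("Since the Fourier series of `|sin x|` is given by `|sin x| = ∑_{m=-∞}^{∞} 2/(π(1−4m²)) e^{2imx}`",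
[RoyVatwani2019, proof of Lemma 7.2]), together with the truncated majorant
`|sin x| ≤ 2/π − (4/π) ∑_{m=1}^{M} cos(2mx)/(4m² − 1) + 1/(M+1)` that a finite computation can use.

## Main results (coefficients written out, `c_m = 2/(π(1 − 4m²))`; no definitions)
- `Literature.Analysis.Fourier.summable_absSin_coeff` : `∑_m |c_m| < ∞`.
- `Literature.Analysis.Fourier.integral_sin_pi_mul_fourier` : `∫₀¹ sin(πx) e^{−2πikx} dx = c_k`.
- `Literature.Analysis.Fourier.hasSum_abs_sin_fourier` : `HasSum (m ↦ c_m e^{2imθ}) |sin θ|` over `ℤ`.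
- `Literature.Analysis.Fourier.hasSum_abs_sin_cos` : the real form, `HasSum (m ↦ c_m cos(2mθ)) |sin θ|`.
- `Literature.Analysis.Fourier.hasSum_abs_sin_nat` : `HasSum (m ↦ (4/(π(4(m+1)²−1))) cos(2(m+1)θ)) (2/π − |sin θ|)`.
- `Literature.Analysis.Fourier.abs_sin_le_truncated` : the truncated majorant displayed above.

The pointwise convergence is Mathlib's `has_pointwise_sum_fourier_series_of_summable`, unwrapped for
`1`-periodic functions on `ℝ` by the tree's
`Literature.NumberTheory.LFunctions.HorocycleStripFourier.hasSum_fourier_of_periodic`.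

## References
- [RoyVatwani2019] A. Roy, A. Vatwani, *Zeros of partial sums of L-functions*, Adv. Math. 346 (2019),
  proof of Lemma 7.2 (the Fourier series of `|sin x|` and "the sum of all the Fourier coefficients is zero").
-/

noncomputable section

open Real Complex MeasureTheory Finset Filter

namespace Literature.Analysis.Fourier

/-- For `m ≠ 0`, `c_m = 2/(π(1 − 4m²)) = -(2/(π(4m² − 1)))` with `4m² − 1 ≥ 3`. [folklore] -/
theorem absSin_coeff_of_ne_zero {m : ℤ} (hm : m ≠ 0) :
    2 / (π * (1 - 4 * (m : ℝ) ^ 2)) = -(2 / (π * (4 * (m : ℝ) ^ 2 - 1))) := by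
  have h1 : (1 : ℝ) ≤ (m : ℝ) ^ 2 := by
    have : (1 : ℤ) ≤ m ^ 2 := by nlinarith [Int.one_le_abs hm, sq_abs m]
    exact_mod_cast this
  have hne : (1 - 4 * (m : ℝ) ^ 2) ≠ 0 := by nlinarith
  have hne' : (4 * (m : ℝ) ^ 2 - 1) ≠ 0 := by nlinarith
  field_simp
  ring

/-- `c_m ≤ 0` for `m ≠ 0`. [folklore] -/
theorem absSin_coeff_nonpos {m : ℤ} (hm : m ≠ 0) : 2 / (π * (1 - 4 * (m : ℝ) ^ 2)) ≤ 0 := by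
  rw [absSin_coeff_of_ne_zero hm, neg_nonpos]
  have h1 : (1 : ℝ) ≤ (m : ℝ) ^ 2 := by
    have : (1 : ℤ) ≤ m ^ 2 := by nlinarith [Int.one_le_abs hm, sq_abs m]
    exact_mod_cast this
  have : 0 < 4 * (m : ℝ) ^ 2 - 1 := by nlinarith
  positivity

/-- `|c_m| ≤ 1/(4m²)` for `m ≠ 0` (since `4m² − 1 ≥ 3m²` and `2/(3π) ≤ 1/4`). [folklore] -/
theorem abs_absSin_coeff_le {m : ℤ} (hm : m ≠ 0) :
    |2 / (π * (1 - 4 * (m : ℝ) ^ 2))| ≤ 1 / (4 * (m : ℝ) ^ 2) := by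
  have h1 : (1 : ℝ) ≤ (m : ℝ) ^ 2 := by
    have : (1 : ℤ) ≤ m ^ 2 := by nlinarith [Int.one_le_abs hm, sq_abs m]
    exact_mod_cast this
  have hpos : 0 < 4 * (m : ℝ) ^ 2 - 1 := by nlinarith
  rw [absSin_coeff_of_ne_zero hm, abs_neg, abs_of_pos (by positivity)]
  rw [div_le_div_iff₀ (by positivity) (by positivity)]
  nlinarith [Real.pi_gt_three]

/-- The coefficients are absolutely summable over `ℤ` (`|c_m| ≤ 1/(4m²)`). [folklore] -/
theorem summable_absSin_coeff : Summable fun m : ℤ => 2 / (π * (1 - 4 * (m : ℝ) ^ 2)) := by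
  have hs : Summable fun k : ℤ => (1 / 4 : ℝ) * |1 / (k : ℝ) ^ 2| :=
    ((Real.summable_one_div_int_pow.mpr (by norm_num)).abs).mul_left (1 / 4)
  refine Summable.of_norm_bounded_eventually hs ?_
  filter_upwards [eventually_cofinite_ne (0 : ℤ)] with k hk
  rw [Real.norm_eq_abs]
  calc |2 / (π * (1 - 4 * (k : ℝ) ^ 2))| ≤ 1 / (4 * (k : ℝ) ^ 2) := abs_absSin_coeff_le hk
    _ = 1 / 4 * |1 / (k : ℝ) ^ 2| := by rw [abs_of_nonneg (by positivity)]; ring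

/-- … and so are their complexifications. [folklore] -/
theorem summable_absSin_coeff_complex :
    Summable fun m : ℤ => ((2 / (π * (1 - 4 * (m : ℝ) ^ 2)) : ℝ) : ℂ) :=
  (summable_absSin_coeff.map Complex.ofRealCLM Complex.continuous_ofReal :)

/-! ### The coefficient integral -/

/-- `e^{iπ(1 - 2k)} = -1` and `e^{-iπ(1+2k)} = -1` for `k ∈ ℤ`: `exp (π I (2j+1)) = -1`. [folklore] -/
theorem exp_pi_mul_I_mul_odd (j : ℤ) : Complex.exp (π * I * (2 * j + 1)) = -1 := by
  rw [show (π : ℂ) * I * (2 * j + 1) = j * (2 * π * I) + π * I by ring, Complex.exp_add,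
    Complex.exp_int_mul_two_pi_mul_I, one_mul, Complex.exp_pi_mul_I]

/-- **The Fourier coefficients of `|sin(πx)|`**: for every `k ∈ ℤ`,
`∫₀¹ sin(πx) e^{−2πikx} dx = 2/(π(1 − 4k²))`
(write `sin(πx) = (e^{iπx} − e^{−iπx})/(2i)` and integrate the two exponentials;
`e^{±iπ(1∓2k)} = −1`). [cite: RoyVatwani2019, proof of Lemma 7.2] -/
theorem integral_sin_pi_mul_fourier (k : ℤ) :
    ∫ x in (0:ℝ)..1, (Real.sin (π * x) : ℂ) * Complex.exp (-(2 * π * I * k * x)) =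
      ((2 / (π * (1 - 4 * (k : ℝ) ^ 2)) : ℝ) : ℂ) := by
  -- the two frequencies
  set a : ℂ := π * I * (1 - 2 * k) with ha
  set b : ℂ := -(π * I * (1 + 2 * k)) with hb
  have hk1 : (1 - 2 * (k : ℂ)) ≠ 0 := by
    intro h
    have h' : (1 - 2 * k : ℤ) = 0 := by exact_mod_cast h
    omega
  have hk2 : (1 + 2 * (k : ℂ)) ≠ 0 := by
    intro h
    have h' : (1 + 2 * k : ℤ) = 0 := by exact_mod_cast h
    omega
  have hπI : (π : ℂ) * I ≠ 0 := mul_ne_zero (by exact_mod_cast Real.pi_ne_zero) I_ne_zero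
  have ha0 : a ≠ 0 := mul_ne_zero hπI hk1
  have hb0 : b ≠ 0 := neg_ne_zero.mpr (mul_ne_zero hπI hk2)
  -- the integrand as a combination of exponentials
  have hint : ∀ x : ℝ, (Real.sin (π * x) : ℂ) * Complex.exp (-(2 * π * I * k * x)) =
      (I / 2) * (Complex.exp (b * x) - Complex.exp (a * x)) := by
    intro x
    rw [Complex.ofReal_sin, Complex.sin]
    push_cast
    have e1 : Complex.exp (-(↑π * ↑x) * I) * Complex.exp (-(2 * ↑π * I * ↑k * ↑x)) =
        Complex.exp (b * x) := by
      rw [← Complex.exp_add]; congr 1; rw [hb]; ring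
    have e2 : Complex.exp (↑π * ↑x * I) * Complex.exp (-(2 * ↑π * I * ↑k * ↑x)) =
        Complex.exp (a * x) := by
      rw [← Complex.exp_add]; congr 1; rw [ha]; ring
    rw [← e1, ← e2]
    ring
  simp_rw [hint]
  rw [intervalIntegral.integral_const_mul, intervalIntegral.integral_sub
    (by apply Continuous.intervalIntegrable; fun_prop)
    (by apply Continuous.intervalIntegrable; fun_prop)]
  rw [integral_exp_mul_complex hb0, integral_exp_mul_complex ha0]
  -- values at the endpoints
  have hea : Complex.exp (a * (1:ℝ)) = -1 := by
    rw [ha, Complex.ofReal_one, mul_one,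
      show (π : ℂ) * I * (1 - 2 * k) = π * I * (2 * ((-k : ℤ) : ℂ) + 1) by push_cast; ring]
    exact exp_pi_mul_I_mul_odd (-k)
  have heb : Complex.exp (b * (1:ℝ)) = -1 := by
    rw [hb, Complex.ofReal_one, mul_one,
      show -((π : ℂ) * I * (1 + 2 * k)) = π * I * (2 * ((-k - 1 : ℤ) : ℂ) + 1) by push_cast; ring]
    exact exp_pi_mul_I_mul_odd (-k - 1)
  rw [hea, heb]
  simp only [Complex.ofReal_zero, mul_zero, Complex.exp_zero]
  -- algebra
  have hπ : (π : ℂ) ≠ 0 := by exact_mod_cast Real.pi_ne_zero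
  have hden : (1 - 4 * (k : ℂ) ^ 2) ≠ 0 := by
    have : (1 - 4 * (k : ℂ) ^ 2) = (1 - 2 * k) * (1 + 2 * k) := by ring
    rw [this]; exact mul_ne_zero hk1 hk2
  have hab : a * b = (π : ℂ) ^ 2 * (1 - 4 * (k : ℂ) ^ 2) := by
    rw [ha, hb]; ring_nf; rw [Complex.I_sq]; ring
  have hπ2 : (π : ℂ) ^ 2 * (1 - 4 * (k : ℂ) ^ 2) ≠ 0 := by rw [← hab]; exact mul_ne_zero ha0 hb0
  have h1 : (-1 - 1) / b - (-1 - 1) / a = 2 * (b - a) / (a * b) := by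
    rw [div_sub_div _ _ hb0 ha0, mul_comm b a]; ring
  have hba : (2 : ℂ) * (b - a) = -(4 * π * I) := by rw [ha, hb]; ring
  rw [h1, hba, hab]
  push_cast
  rw [show I / 2 * (-(4 * ↑π * I) / (↑π ^ 2 * (1 - 4 * (k : ℂ) ^ 2))) =
      (-(2 * I ^ 2)) * ↑π / (↑π ^ 2 * (1 - 4 * (k : ℂ) ^ 2)) by ring, Complex.I_sq,
    div_eq_div_iff hπ2 (mul_ne_zero hπ hden)]
  ring

/-! ### Pointwise convergence -/

/-- **The Fourier series of `|sin|`** (complex form): for every real `θ`,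
`|sin θ| = ∑_{m ∈ ℤ} (2/(π(1 − 4m²))) e^{2imθ}`, the series converging absolutely.
[cite: RoyVatwani2019, proof of Lemma 7.2] -/
theorem hasSum_abs_sin_fourier (θ : ℝ) :
    HasSum (fun m : ℤ =>
      ((2 / (π * (1 - 4 * (m : ℝ) ^ 2)) : ℝ) : ℂ) * Complex.exp (2 * m * θ * I))
      ((|Real.sin θ| : ℝ) : ℂ) := by
  -- the `1`-periodic continuous function `Φ(x) = |sin(πx)|`
  set Φ : ℝ → ℂ := fun x => ((|Real.sin (π * x)| : ℝ) : ℂ) with hΦ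
  have hΦc : Continuous Φ := by
    simp only [hΦ]; fun_prop
  have hΦp : ∀ x, Φ (x + 1) = Φ x := by
    intro x
    simp only [hΦ, mul_add, mul_one, Real.sin_add_pi, abs_neg]
  -- its Fourier coefficients
  have hcoef : ∀ k : ℤ, (∫ x in (0:ℝ)..1, Φ x * Complex.exp (-(2 * π * I * k * x))) =
      ((2 / (π * (1 - 4 * (k : ℝ) ^ 2)) : ℝ) : ℂ) := by
    intro k
    rw [← integral_sin_pi_mul_fourier k]
    refine intervalIntegral.integral_congr fun x hx => ?_
    rw [Set.uIcc_of_le zero_le_one, Set.mem_Icc] at hx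
    simp only [hΦ]
    rw [abs_of_nonneg (Real.sin_nonneg_of_nonneg_of_le_pi (mul_nonneg Real.pi_pos.le hx.1)
      (by nlinarith [Real.pi_pos, hx.2]))]
  have hsum : Summable fun k : ℤ => ∫ x in (0:ℝ)..1, Φ x * Complex.exp (-(2 * π * I * k * x)) := by
    simp_rw [hcoef]; exact summable_absSin_coeff_complex
  have h := Literature.NumberTheory.LFunctions.HorocycleStripFourier.hasSum_fourier_of_periodic
    hΦc hΦp hsum (θ / π)
  simp_rw [hcoef] at h
  have hθ : Φ (θ / π) = ((|Real.sin θ| : ℝ) : ℂ) := by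
    simp only [hΦ, mul_div_cancel₀ θ Real.pi_ne_zero]
  rw [hθ] at h
  convert h using 2 with m
  congr 1
  have hπ : (π : ℂ) ≠ 0 := by exact_mod_cast Real.pi_ne_zero
  push_cast
  field_simp

/-- **The Fourier series of `|sin|`** (real form): `|sin θ| = ∑_{m ∈ ℤ} c_m cos(2mθ)`,
`c_m = 2/(π(1−4m²))`. [cite: RoyVatwani2019, proof of Lemma 7.2] -/
theorem hasSum_abs_sin_cos (θ : ℝ) :
    HasSum (fun m : ℤ => 2 / (π * (1 - 4 * (m : ℝ) ^ 2)) * Real.cos (2 * m * θ)) |Real.sin θ| := by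
  have h := (hasSum_abs_sin_fourier θ).mapL Complex.reCLM
  simp only [Complex.reCLM_apply, Complex.ofReal_re] at h
  convert h using 2 with m
  rw [Complex.re_ofReal_mul, show (2 : ℂ) * m * θ * I = ((2 * m * θ : ℝ) : ℂ) * I by push_cast; ring,
    Complex.exp_ofReal_mul_I_re]

/-- The one-sided form over `ℕ`: `2/π − |sin θ| = ∑_{m ≥ 1} (4/(π(4m² − 1))) cos(2mθ)`
(fold `m` and `−m` together, `c_{−m} = c_m`, `cos` even).
[cite: RoyVatwani2019, proof of Lemma 7.2] -/
theorem hasSum_abs_sin_nat (θ : ℝ) :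
    HasSum (fun m : ℕ => 4 / (π * (4 * ((m : ℝ) + 1) ^ 2 - 1)) * Real.cos (2 * ((m : ℝ) + 1) * θ))
      (2 / π - |Real.sin θ|) := by
  have h := (hasSum_abs_sin_cos θ).nat_add_neg
  -- `h : HasSum (fun n ↦ f n + f (-n)) (|sin θ| + f 0)`; peel off the term `n = 0`
  have h1 := (hasSum_nat_add_iff' 1).mpr h
  simp only [Finset.range_one, Finset.sum_singleton, Nat.cast_zero, Int.cast_zero, mul_zero,
    zero_mul, Real.cos_zero, mul_one, neg_zero, sub_zero, ne_eq, OfNat.ofNat_ne_zero,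
    not_false_eq_true, zero_pow] at h1
  have h2 := h1.neg
  have h3 : HasSum (fun m : ℕ =>
      4 / (π * (4 * ((m : ℝ) + 1) ^ 2 - 1)) * Real.cos (2 * ((m : ℝ) + 1) * θ))
      (-(|Real.sin θ| + 2 / π - (2 / π + 2 / π))) := by
    refine h2.congr_fun fun m => ?_
    have hx1 : (1 : ℝ) ≤ ((m : ℝ) + 1) ^ 2 := by nlinarith [Nat.cast_nonneg (α := ℝ) m]
    have hne : (1 - 4 * ((m : ℝ) + 1) ^ 2) ≠ 0 := by nlinarith
    have hne' : (4 * ((m : ℝ) + 1) ^ 2 - 1) ≠ 0 := by nlinarith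
    push_cast
    rw [show (2 : ℝ) * -((m : ℝ) + 1) * θ = -(2 * ((m : ℝ) + 1) * θ) by ring, Real.cos_neg,
      show (-((m : ℝ) + 1)) ^ 2 = ((m : ℝ) + 1) ^ 2 by ring]
    field_simp
    ring
  convert h3 using 1
  ring

/-- Positivity of the shifted coefficients `4/(π(4(m+M+1)²−1))`. [folklore] -/
theorem tail_coeff_pos (M m : ℕ) : 0 < 4 / (π * (4 * (((m + M : ℕ) : ℝ) + 1) ^ 2 - 1)) := by
  have h1 : (1 : ℝ) ≤ ((m + M : ℕ) : ℝ) + 1 := by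
    have := Nat.cast_nonneg (α := ℝ) (m + M); linarith
  have : 0 < 4 * (((m + M : ℕ) : ℝ) + 1) ^ 2 - 1 := by nlinarith
  positivity

/-- Termwise telescoping bound `4/(π(4x²−1)) ≤ 1/x − 1/(x+1)` for `x = m+M+1 ≥ 1` (uses `π > 3`).
[folklore] -/
theorem tail_coeff_le (M m : ℕ) :
    4 / (π * (4 * (((m + M : ℕ) : ℝ) + 1) ^ 2 - 1)) ≤
      1 / (((m + M : ℕ) : ℝ) + 1) - 1 / (((m + M : ℕ) : ℝ) + 2) := by
  set x : ℝ := ((m + M : ℕ) : ℝ) + 1 with hx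
  have hx1 : 1 ≤ x := by rw [hx]; have := Nat.cast_nonneg (α := ℝ) (m + M); linarith
  have hsub : 1 / x - 1 / (((m + M : ℕ) : ℝ) + 2) = 1 / (x * (x + 1)) := by
    rw [show ((m + M : ℕ) : ℝ) + 2 = x + 1 by rw [hx]; ring]
    field_simp
    ring
  have h4 : (0 : ℝ) ≤ 4 * x ^ 2 - 1 := by nlinarith
  rw [hsub, div_le_div_iff₀ (mul_pos Real.pi_pos (by nlinarith)) (by positivity)]
  nlinarith [Real.pi_gt_three, mul_nonneg (sub_pos.2 Real.pi_gt_three).le h4,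
    mul_nonneg (sub_nonneg.2 hx1) (sub_nonneg.2 hx1)]

/-- The telescoping series `∑_m (1/(m+M+1) − 1/(m+M+2)) = 1/(M+1)`. [folklore] -/
theorem hasSum_telescope (M : ℕ) :
    HasSum (fun m : ℕ => 1 / (((m + M : ℕ) : ℝ) + 1) - 1 / (((m + M : ℕ) : ℝ) + 2))
      (1 / ((M : ℝ) + 1)) := by
  refine (hasSum_iff_tendsto_nat_of_nonneg (fun m => ?_) _).2 ?_
  · exact (tail_coeff_pos M m).le.trans (tail_coeff_le M m)
  · have hsum : ∀ n : ℕ, ∑ m ∈ Finset.range n,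
        (1 / (((m + M : ℕ) : ℝ) + 1) - 1 / (((m + M : ℕ) : ℝ) + 2)) =
        1 / ((M : ℝ) + 1) - 1 / ((n : ℝ) + M + 1) := by
      intro n
      induction n with
      | zero => simp
      | succ n ih =>
        rw [Finset.sum_range_succ, ih]
        push_cast
        ring
    simp_rw [hsum]
    have hlim : Tendsto (fun n : ℕ => 1 / ((n : ℝ) + M + 1)) atTop (nhds 0) := by
      have h1 : Tendsto (fun n : ℕ => (n : ℝ) + M + 1) atTop atTop := by
        refine tendsto_atTop_add_const_right _ _ (tendsto_atTop_add_const_right _ _ ?_)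
        exact tendsto_natCast_atTop_atTop
      have h2 := tendsto_inv_atTop_zero.comp h1
      simp only [Function.comp_def] at h2
      simpa [one_div] using h2
    simpa using (tendsto_const_nhds (x := 1 / ((M : ℝ) + 1))).sub hlim

/-- The shifted coefficients are summable. [folklore] -/
theorem summable_tail_coeff (M : ℕ) :
    Summable fun m : ℕ => 4 / (π * (4 * (((m + M : ℕ) : ℝ) + 1) ^ 2 - 1)) :=
  Summable.of_nonneg_of_le (fun m => (tail_coeff_pos M m).le) (tail_coeff_le M)
    (hasSum_telescope M).summable

/-- Tail bound: `∑_{m ≥ 0} 4/(π(4(m+M+1)²−1)) ≤ 1/(M+1)`. [folklore] -/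
theorem tsum_tail_coeff_le (M : ℕ) :
    ∑' m : ℕ, 4 / (π * (4 * (((m + M : ℕ) : ℝ) + 1) ^ 2 - 1)) ≤ 1 / ((M : ℝ) + 1) :=
  calc ∑' m : ℕ, 4 / (π * (4 * (((m + M : ℕ) : ℝ) + 1) ^ 2 - 1))
      ≤ ∑' m : ℕ, (1 / (((m + M : ℕ) : ℝ) + 1) - 1 / (((m + M : ℕ) : ℝ) + 2)) :=
        (summable_tail_coeff M).tsum_le_tsum (tail_coeff_le M) (hasSum_telescope M).summable
    _ = 1 / ((M : ℝ) + 1) := (hasSum_telescope M).tsum_eq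

/-- **Truncated Fourier majorant of `|sin|`**: for all `M : ℕ` and real `θ`,
`|sin θ| ≤ 2/π − ∑_{m=1}^{M} (4/(π(4m²−1))) cos(2mθ) + 1/(M+1)`
(the tail of the absolutely convergent series is at most `∑_{m > M} 4/(π(4m²−1)) ≤ 1/(M+1)`).
[cite: RoyVatwani2019, proof of Lemma 7.2] -/
theorem abs_sin_le_truncated (M : ℕ) (θ : ℝ) :
    |Real.sin θ| ≤ 2 / π - ∑ m ∈ Finset.range M,
        4 / (π * (4 * ((m : ℝ) + 1) ^ 2 - 1)) * Real.cos (2 * ((m : ℝ) + 1) * θ) +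
      1 / ((M : ℝ) + 1) := by
  set f : ℕ → ℝ := fun m =>
    4 / (π * (4 * ((m : ℝ) + 1) ^ 2 - 1)) * Real.cos (2 * ((m : ℝ) + 1) * θ) with hf
  have h := hasSum_abs_sin_nat θ
  have hsplit := h.summable.sum_add_tsum_nat_add M
  rw [h.tsum_eq] at hsplit
  -- the tail is bounded below by `-1/(M+1)`
  have hle : ∀ m : ℕ, -(4 / (π * (4 * (((m + M : ℕ) : ℝ) + 1) ^ 2 - 1))) ≤ f (m + M) := by
    intro m
    have hc := (tail_coeff_pos M m).le
    simp only [hf]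
    nlinarith [Real.neg_one_le_cos (2 * (((m + M : ℕ) : ℝ) + 1) * θ), hc]
  have hs1 : Summable fun m : ℕ => f (m + M) := (summable_nat_add_iff M).2 h.summable
  have htail : -(1 / ((M : ℝ) + 1)) ≤ ∑' m : ℕ, f (m + M) := by
    calc -(1 / ((M : ℝ) + 1)) ≤ -∑' m : ℕ, 4 / (π * (4 * (((m + M : ℕ) : ℝ) + 1) ^ 2 - 1)) :=
          neg_le_neg (tsum_tail_coeff_le M)
      _ = ∑' m : ℕ, -(4 / (π * (4 * (((m + M : ℕ) : ℝ) + 1) ^ 2 - 1))) := tsum_neg.symm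
      _ ≤ ∑' m : ℕ, f (m + M) := (summable_tail_coeff M).neg.tsum_le_tsum hle hs1
  have hf' : ∑ m ∈ Finset.range M, f m + ∑' m : ℕ, f (m + M) = 2 / π - |Real.sin θ| := hsplit
  linarith

end Literature.Analysis.Fourier
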